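import Summits.CriticalPhenomena.PercolationContinuityZ3.Theorems.Transplant.CayleyZ2RotC4SideOn
import Summits.CriticalPhenomena.PercolationContinuityZ3.Theorems.Transplant.SkelFrmScaledAlignedHoldsAll
import HarnessLib

/-!
# `θ(p_c) = 0` on `X′ = Cay(ℤ² ⋊ C₄; ρ, x, ρxρ⁻¹)` — a Cayley graph of a group with FINITE ABELIANISATION (`b₁ = 0`), UNCONDITIONALLY:
# the rotor square lattice with side-steps carries a FOUR-type chart-aligned `PlanarSkeletonFrmFrom` (first customer of the multi-type nodes p486426 / p491075
# that NO one-type node reaches)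

builds on p205010 (kernel theorem, internal audit signed; external expert review pending): the unconditional theorem of this file runs through
`frmFromAligned_criticalContinuity_holds` («SkelFrmScaledAlignedHoldsAll» §2, p491075) over the GEN node with proxies «SkelFrmFromProxHoldsAll» p486426, which
build on p205010.  Lane `prim-bschramm`, seat `prim-bschramm-p5` gen 27 (refuter / sharpness seat: the POSITIVE VACUITY CONTROL of AUDIT-ALIGNED — the hypothesis
class 'multi-type, chart-aligned, NOT one-type-able' is inhabited by a Cayley graph).  Helper file (`--supports stmt-CriticalPhenomena-4575 --as helper`); no node,
no statement, no `@[conjecture]` is declared or edited; nothing about the end-state node or Conj. 4 in general is claimed.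

WHY.  `Γ = ℤ² ⋊ C₄` (`ρ` = rotation by a quarter turn) has `b₁(Γ) = 0` (`Γ^{ab}` is finite), so NO Cayley graph of `Γ` carries a one-type planar skeleton whose
frames are left translations (a chart translated by a vertex-transitive group of left translations is an additive character of rank two — there is none); its
finite-index subgroup `ℤ²` surjects onto `ℤ²`, so `Γ` is the smallest member of the class 'virtually onto `ℤ²`, not onto `ℤ²`' of NEXT-SCOPE (p3-g27) §2 / (N3).
For the alphabet `{ρ, x}` the Cayley graph is the ROTOR SQUARE LATTICE `X` of «CayleyZ2RotC4SideOn» (`Z2Rot.graph`: a move along the heading, a turn), on which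
the coset chart has axis steps in ONE direction per heading only (gen-1 g3 #5822 (3), P5-SHARPNESS §59.1) — no single-edge-step carrier fits.  For the alphabet
`{ρ, x, y := ρxρ⁻¹}` (`y` = the unit translation ORTHOGONAL to the heading) the Cayley graph is `X′`: vertices `(v, k) ∈ ℤ² × ℤ/4`, bonds `(v,k) ∼ (v ± ρ^k e₀, k)`
(move), `(v,k) ∼ (v ± ρ^{k+1} e₀, k)` (side-step), `(v,k) ∼ (v, k ± 1)` (turn); and `X′` carries the `PlanarSkeletonFrmFrom` `Φ(v,k) := v` with FOUR base types
`((0,0), k)`: 1-Lipschitz, frames = the left translations by `ℤ²` (`shiftIso`), unit steps in all four axis directions at every vertex along SINGLE edges (move or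
side-step), degree `≤ 6`, box cylinders `{(w,k) : ‖w‖_∞ ≤ ℓ}` connected for every `ℓ`; the chart is CONSTANT (`= 0`) on the four types, so they are pairwise
chart-aligned with `α := 1`.  Hence («SkelFrmScaledAlignedHoldsAll» `frmFromAligned_criticalContinuity_holds`):
**`Z2RotSide.criticalContinuity : ∀ v, θ_v(p_c(X′)) = 0` — unconditional.**  (The identification `X′ = Cay(ℤ² ⋊ C₄; ρ, x, ρxρ⁻¹)` — right multiplication by
`x = (e₀, 1)`, `y = (e₁, 1)`, `ρ = (0, R)` on `(v, R^k)` — is read in coordinates and stated, not typed, here; `X ≤ X′` is `rot_le`.)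
[cite: BenjaminiSchramm1996, Conj. 4; §2 (Cayley graphs)] [cite: KozmaNitzan2024, §4 p. 16 (Lemma 8: the lattice symmetries)] [this work]
-/

noncomputable section

namespace Summit.CriticalPhenomena.PercolationContinuityZ3.Theorems.Transplant

open MeasureTheory Literature.Probability.Percolation Literature.Probability.LatticeModels SimpleGraph
open scoped Classical

namespace Z2RotSide

open Z2Rot (dir dir_ne_zero Vtx types mem_types coords_move)

/-! ## §1 The rotor square lattice with side-steps `X′ = Cay(ℤ² ⋊ C₄; ρ, x, ρxρ⁻¹)` -/

/-- **The rotor square lattice with side-steps** `X′`: generating relation = a move along the heading, a side-step (along the next heading), or a left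
turn. [cite: BenjaminiSchramm1996, §2 (Cayley graphs)] -/
def graph : SimpleGraph Vtx :=
  SimpleGraph.fromRel fun a b => (b.2 = a.2 ∧ b.1 = a.1 + dir a.2) ∨ (b.2 = a.2 ∧ b.1 = a.1 + dir (a.2 + 1)) ∨ (b.1 = a.1 ∧ b.2 = a.2 + 1)

/-- Adjacency unfolded. [folklore] -/
theorem adj_iff (a b : Vtx) : graph.Adj a b ↔ a ≠ b ∧
    (((b.2 = a.2 ∧ b.1 = a.1 + dir a.2) ∨ (b.2 = a.2 ∧ b.1 = a.1 + dir (a.2 + 1)) ∨ (b.1 = a.1 ∧ b.2 = a.2 + 1)) ∨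
      ((a.2 = b.2 ∧ a.1 = b.1 + dir b.2) ∨ (a.2 = b.2 ∧ a.1 = b.1 + dir (b.2 + 1)) ∨ (a.1 = b.1 ∧ a.2 = b.2 + 1))) :=
  SimpleGraph.fromRel_adj _ _ _

/-- A vertex differs from its translate by a heading vector. [folklore] -/
theorem ne_add_dir (v : Site 2) (k m : Fin 4) : ((v, k) : Vtx) ≠ (v + dir m, k) := fun h => by
  have := congrArg Prod.fst h
  exact dir_ne_zero m (by simpa using this.symm)

/-- A move along the heading is a bond. [folklore] -/
theorem adj_move (v : Site 2) (k : Fin 4) : graph.Adj (v, k) (v + dir k, k) :=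
  (adj_iff _ _).2 ⟨ne_add_dir v k k, Or.inl (Or.inl ⟨rfl, rfl⟩)⟩

/-- A move against the heading is a bond. [folklore] -/
theorem adj_move' (v : Site 2) (k : Fin 4) : graph.Adj (v, k) (v - dir k, k) := by
  have := (adj_move (v - dir k) k).symm
  rwa [sub_add_cancel] at this

/-- A side-step (along the next heading) is a bond. [folklore] -/
theorem adj_side (v : Site 2) (k : Fin 4) : graph.Adj (v, k) (v + dir (k + 1), k) :=
  (adj_iff _ _).2 ⟨ne_add_dir v k (k + 1), Or.inl (Or.inr (Or.inl ⟨rfl, rfl⟩))⟩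

/-- A side-step against the next heading is a bond. [folklore] -/
theorem adj_side' (v : Site 2) (k : Fin 4) : graph.Adj (v, k) (v - dir (k + 1), k) := by
  have := (adj_side (v - dir (k + 1)) k).symm
  rwa [sub_add_cancel] at this

/-- A left turn is a bond. [folklore] -/
theorem adj_turn (v : Site 2) (k : Fin 4) : graph.Adj (v, k) (v, k + 1) := by
  refine (adj_iff _ _).2 ⟨fun h => ?_, Or.inl (Or.inr (Or.inr ⟨rfl, rfl⟩))⟩
  have h2 : k = k + 1 := by simpa using congrArg Prod.snd h
  revert h2
  fin_cases k <;> decide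

/-- A right turn is a bond. [folklore] -/
theorem adj_turn' (v : Site 2) (k : Fin 4) : graph.Adj (v, k) (v, k - 1) := by
  have := (adj_turn v (k - 1)).symm
  rwa [sub_add_cancel] at this

/-- The six candidates for a neighbour. [folklore] -/
def nbrs (a : Vtx) : Finset Vtx :=
  {(a.1 + dir a.2, a.2), (a.1 - dir a.2, a.2), (a.1 + dir (a.2 + 1), a.2), (a.1 - dir (a.2 + 1), a.2), (a.1, a.2 + 1), (a.1, a.2 - 1)}

/-- Every neighbour is one of the six candidates. [folklore] -/
theorem mem_nbrs_of_adj {a b : Vtx} (h : graph.Adj a b) : b ∈ nbrs a := by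
  obtain ⟨-, h | h⟩ := (adj_iff a b).1 h
  · rcases h with ⟨h2, h1⟩ | ⟨h2, h1⟩ | ⟨h1, h2⟩
    · have : b = (a.1 + dir a.2, a.2) := Prod.ext h1 h2
      simp [nbrs, this]
    · have : b = (a.1 + dir (a.2 + 1), a.2) := Prod.ext h1 h2
      simp [nbrs, this]
    · have : b = (a.1, a.2 + 1) := Prod.ext h1 h2
      simp [nbrs, this]
  · rcases h with ⟨h2, h1⟩ | ⟨h2, h1⟩ | ⟨h1, h2⟩
    · have : b = (a.1 - dir a.2, a.2) := by
        refine Prod.ext ?_ h2.symm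
        show b.1 = a.1 - dir a.2
        rw [h1, h2, add_sub_cancel_right]
      simp [nbrs, this]
    · have : b = (a.1 - dir (a.2 + 1), a.2) := by
        refine Prod.ext ?_ h2.symm
        show b.1 = a.1 - dir (a.2 + 1)
        rw [h1, h2, add_sub_cancel_right]
      simp [nbrs, this]
    · have : b = (a.1, a.2 - 1) := by
        refine Prod.ext h1.symm ?_
        show b.2 = a.2 - 1
        rw [h2, add_sub_cancel_right]
      simp [nbrs, this]

/-- The neighbour set lies in the candidate set. [folklore] -/
theorem neighborSet_subset (a : Vtx) : graph.neighborSet a ⊆ ↑(nbrs a) := fun _ hb => mem_nbrs_of_adj hb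

/-- `X′` is locally finite. [folklore] -/
instance graph_locallyFinite : graph.LocallyFinite := fun a => ((Finset.finite_toSet _).subset (neighborSet_subset a)).fintype

/-- Every vertex has degree `≤ 6`. [folklore] -/
theorem degree_le (a : Vtx) : graph.degree a ≤ 6 := by
  rw [← card_neighborFinset_eq_degree]
  have hsub : graph.neighborFinset a ⊆ nbrs a := fun b hb => mem_nbrs_of_adj ((mem_neighborFinset _ _ _).1 hb)
  refine (Finset.card_le_card hsub).trans ?_
  unfold nbrs
  refine (Finset.card_insert_le _ _).trans (Nat.succ_le_succ ?_)
  refine (Finset.card_insert_le _ _).trans (Nat.succ_le_succ ?_)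
  refine (Finset.card_insert_le _ _).trans (Nat.succ_le_succ ?_)
  refine (Finset.card_insert_le _ _).trans (Nat.succ_le_succ ?_)
  refine (Finset.card_insert_le _ _).trans (Nat.succ_le_succ ?_)
  rw [Finset.card_singleton]

/-- **The rotor square lattice is a spanning subgraph of `X′`** (`X ≤ X′`: drop the side-steps). [folklore] -/
theorem rot_le : Z2Rot.graph ≤ graph := by
  intro a b h
  obtain ⟨hne, h | h⟩ := (Z2Rot.adj_iff a b).1 h
  · refine (adj_iff a b).2 ⟨hne, Or.inl ?_⟩
    rcases h with h | h
    · exact Or.inl h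
    · exact Or.inr (Or.inr h)
  · refine (adj_iff a b).2 ⟨hne, Or.inr ?_⟩
    rcases h with h | h
    · exact Or.inl h
    · exact Or.inr (Or.inr h)

/-! ## §2 Frames: the left translations by `ℤ²` -/

/-- Translating the position preserves adjacency. [folklore] -/
theorem adj_shift {a b : Vtx} (u : Site 2) (h : graph.Adj a b) : graph.Adj (a.1 + u, a.2) (b.1 + u, b.2) := by
  have hb := mem_nbrs_of_adj h
  simp only [nbrs, Finset.mem_insert, Finset.mem_singleton] at hb
  rcases hb with rfl | rfl | rfl | rfl | rfl | rfl
  · have e : (a.1 + dir a.2 + u, a.2) = (a.1 + u + dir a.2, a.2) := by rw [add_right_comm]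
    rw [e]; exact adj_move _ _
  · have e : (a.1 - dir a.2 + u, a.2) = (a.1 + u - dir a.2, a.2) := by rw [sub_add_eq_add_sub]
    rw [e]; exact adj_move' _ _
  · have e : (a.1 + dir (a.2 + 1) + u, a.2) = (a.1 + u + dir (a.2 + 1), a.2) := by rw [add_right_comm]
    rw [e]; exact adj_side _ _
  · have e : (a.1 - dir (a.2 + 1) + u, a.2) = (a.1 + u - dir (a.2 + 1), a.2) := by rw [sub_add_eq_add_sub]
    rw [e]; exact adj_side' _ _
  · exact adj_turn _ _
  · exact adj_turn' _ _

/-- **Translation of the position** `(w, m) ↦ (w + u, m)` (left multiplication by `u ∈ ℤ² ⊴ ℤ² ⋊ C₄`): the FRAMES of the skeleton. [cite: BenjaminiSchramm1996, §2] -/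
def shiftIso (u : Site 2) : graph ≃g graph where
  toEquiv := Equiv.prodCongr (Equiv.addRight u) (Equiv.refl _)
  map_rel_iff' := by
    intro a b
    show graph.Adj (a.1 + u, a.2) (b.1 + u, b.2) ↔ graph.Adj a b
    refine ⟨fun h => ?_, adj_shift u⟩
    have := adj_shift (-u) h
    simpa using this

/-! ## §3 The chart `(v, k) ↦ v`: Lipschitz, and SINGLE-EDGE unit steps in all four axis directions at every heading -/

/-- The heading vectors are unit vectors. [folklore] -/
theorem abs_dir_le (k : Fin 4) (i : Fin 2) : |dir k i| ≤ 1 := by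
  fin_cases k <;> fin_cases i <;> simp [dir]

/-- Along a bond the position changes by at most one in each coordinate. [folklore] -/
theorem abs_sub_le {a b : Vtx} (h : graph.Adj a b) (i : Fin 2) : |a.1 i - b.1 i| ≤ 1 := by
  have hb := mem_nbrs_of_adj h
  simp only [nbrs, Finset.mem_insert, Finset.mem_singleton] at hb
  obtain ⟨v, k⟩ := a
  rcases hb with rfl | rfl | rfl | rfl | rfl | rfl
  · simpa using abs_dir_le k i
  · simpa using abs_dir_le k i
  · simpa using abs_dir_le (k + 1) i
  · simpa using abs_dir_le (k + 1) i
  · simp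
  · simp

/-- The four single-edge displacements available at heading `k`: `±ρ^k e₀` (move) and `±ρ^{k+1} e₀` (side-step). [folklore] -/
theorem adj_add_of_mem (v : Site 2) (k : Fin 4) {u : Site 2} (hu : u = dir k ∨ u = -dir k ∨ u = dir (k + 1) ∨ u = -dir (k + 1)) :
    graph.Adj (v, k) (v + u, k) := by
  rcases hu with rfl | rfl | rfl | rfl
  · exact adj_move v k
  · rw [← sub_eq_add_neg]; exact adj_move' v k
  · exact adj_side v k
  · rw [← sub_eq_add_neg]; exact adj_side' v k

/-- At every heading the four displacements are exactly the four unit vectors `±e₀, ±e₁`. [folklore] -/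
theorem single_mem_dirs (k : Fin 4) (i : Fin 2) (σ : ℤˣ) :
    Pi.single i (σ : ℤ) = dir k ∨ Pi.single i (σ : ℤ) = -dir k ∨ Pi.single i (σ : ℤ) = dir (k + 1) ∨ Pi.single i (σ : ℤ) = -dir (k + 1) := by
  rcases Int.units_eq_one_or σ with rfl | rfl <;> fin_cases i <;> fin_cases k <;> simp [dir] <;> decide

/-- **(ι) at every vertex: a SINGLE EDGE realising each of the four unit displacements `±e₀, ±e₁`** — the move or the side-step, according to the heading.
[this work] -/
theorem exists_step (v : Site 2) (k : Fin 4) (i : Fin 2) (σ : ℤˣ) : ∃ b : Vtx, graph.Adj (v, k) b ∧ b.1 = v + Pi.single i (σ : ℤ) :=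
  ⟨(v + Pi.single i (σ : ℤ), k), adj_add_of_mem v k (single_mem_dirs k i σ), rfl⟩

/-! ## §4 Box cylinders are connected -/

/-- The box cylinder of half-width `ℓ`: positions in `[−ℓ, ℓ]²`, any heading. [folklore] -/
abbrev boxSet (ℓ : ℕ) : Set Vtx := {w | w.1 ∈ box 2 ℓ}

/-- Membership in the box cylinder. [folklore] -/
theorem mem_boxSet {ℓ : ℕ} {w : Vtx} : w ∈ boxSet ℓ ↔ ∀ i, -(ℓ : ℤ) ≤ w.1 i ∧ w.1 i ≤ ℓ := by
  rw [Set.mem_setOf_eq, mem_box]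

/-- Membership in the box cylinder, two coordinates. [folklore] -/
theorem mem_boxSet₂ {ℓ : ℕ} {v : Site 2} {k : Fin 4} :
    ((v, k) : Vtx) ∈ boxSet ℓ ↔ (-(ℓ : ℤ) ≤ v 0 ∧ v 0 ≤ ℓ) ∧ (-(ℓ : ℤ) ≤ v 1 ∧ v 1 ≤ ℓ) := by
  rw [mem_boxSet]
  exact ⟨fun h => ⟨h 0, h 1⟩, fun h i => by fin_cases i <;> [exact h.1; exact h.2]⟩

/-- One induced step. [folklore] -/
theorem boxAdj {ℓ : ℕ} {a b : Vtx} (ha : a ∈ boxSet ℓ) (hb : b ∈ boxSet ℓ) (h : graph.Adj a b) :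
    (graph.induce (boxSet ℓ)).Adj ⟨a, ha⟩ ⟨b, hb⟩ := h

/-- Turning keeps the box: `(v, k)` is joined to `(v, 0)` inside every box cylinder containing it. [folklore] -/
theorem reachable_turn {ℓ : ℕ} (v : Site 2) (k : Fin 4) (h : ((v, k) : Vtx) ∈ boxSet ℓ) :
    (graph.induce (boxSet ℓ)).Reachable ⟨(v, k), h⟩ ⟨(v, 0), h⟩ := by
  have hm : ∀ m : Fin 4, ((v, m) : Vtx) ∈ boxSet ℓ := fun _ => h
  have st : ∀ m : Fin 4, (graph.induce (boxSet ℓ)).Reachable ⟨(v, m), hm m⟩ ⟨(v, m - 1), hm (m - 1)⟩ :=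
    fun m => (boxAdj (hm m) (hm (m - 1)) (adj_turn' v m)).reachable
  fin_cases k
  · rfl
  · exact st 1
  · exact (st 2).trans (st 1)
  · exact ((st 3).trans (st 2)).trans (st 1)

/-- **Every vertex of the box cylinder is joined to `((0,0), 0)` inside it**: turn to heading `0`, then walk the position to `0` by single moves `∓e₀` (heading)
and side-steps `∓e₁`, each decreasing `|v₀| + |v₁|` and staying in the box. [folklore] -/
theorem reachable_zero {ℓ : ℕ} (w : Vtx) (hw : w ∈ boxSet ℓ) :
    (graph.induce (boxSet ℓ)).Reachable ⟨w, hw⟩ ⟨((0 : Site 2), 0), by rw [mem_boxSet]; simp⟩ := by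
  obtain ⟨v, k⟩ := w
  refine (reachable_turn v k hw).trans ?_
  have hv0 : ((v, (0 : Fin 4)) : Vtx) ∈ boxSet ℓ := hw
  suffices H : ∀ n : ℕ, ∀ (v : Site 2) (hv : ((v, (0 : Fin 4)) : Vtx) ∈ boxSet ℓ), (v 0).natAbs + (v 1).natAbs = n →
      (graph.induce (boxSet ℓ)).Reachable ⟨(v, 0), hv⟩ ⟨((0 : Site 2), 0), by rw [mem_boxSet]; simp⟩ from H _ v hv0 rfl
  intro n
  induction n using Nat.strong_induction_on with
  | _ n ih =>
    intro v hv hn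
    have hb := mem_boxSet₂.1 hv
    obtain ⟨⟨c00, c01⟩, ⟨c10, c11⟩, ⟨c20, c21⟩, ⟨c30, c31⟩⟩ := coords_move v
    by_cases h00 : v 0 = 0 ∧ v 1 = 0
    · have : v = 0 := by funext j; fin_cases j <;> simp [h00.1, h00.2]
      subst this; rfl
    by_cases hA : v 0 < 0
    · -- move `+e₀` along heading `0`
      have hm : ((v + dir 0, (0 : Fin 4)) : Vtx) ∈ boxSet ℓ := by rw [mem_boxSet₂, c00, c01]; omega
      exact (boxAdj hv hm (adj_move v 0)).reachable.trans (ih _ (by rw [← hn, c00, c01]; omega) _ hm rfl)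
    by_cases hB : 0 < v 0
    · -- move `−e₀`
      have hm : ((v - dir 0, (0 : Fin 4)) : Vtx) ∈ boxSet ℓ := by rw [mem_boxSet₂, c10, c11]; omega
      exact (boxAdj hv hm (adj_move' v 0)).reachable.trans (ih _ (by rw [← hn, c10, c11]; omega) _ hm rfl)
    by_cases hC : v 1 < 0
    · -- side-step `+e₁`
      have hm : ((v + dir 1, (0 : Fin 4)) : Vtx) ∈ boxSet ℓ := by rw [mem_boxSet₂, c20, c21]; omega
      exact (boxAdj hv hm (adj_side v 0)).reachable.trans (ih _ (by rw [← hn, c20, c21]; omega) _ hm rfl)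
    · -- side-step `−e₁` (the remaining case `v 1 > 0`)
      have hD : 0 < v 1 := by omega
      have hm : ((v - dir 1, (0 : Fin 4)) : Vtx) ∈ boxSet ℓ := by rw [mem_boxSet₂, c30, c31]; omega
      exact (boxAdj hv hm (adj_side' v 0)).reachable.trans (ih _ (by rw [← hn, c30, c31]; omega) _ hm rfl)

/-- The box cylinders are connected. [folklore] -/
theorem boxSet_connected (ℓ : ℕ) : (graph.induce (boxSet ℓ)).Connected :=
  haveI : Nonempty (boxSet ℓ) := ⟨⟨((0 : Site 2), 0), by rw [mem_boxSet]; simp⟩⟩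
  Connected.mk fun a b => (reachable_zero a.1 a.2).trans (reachable_zero b.1 b.2).symm

/-! ## §5 The four-type chart-aligned skeleton and the unconditional theorem -/

/-- **`X′` CARRIES A `PlanarSkeletonFrmFrom` WITH FOUR BASE TYPES** `((0,0), k)`: chart = position, frames = translations, degree `≤ 6`, single-edge unit steps in
all four axis directions at every vertex, box cylinders connected from width `0` on. [this work] -/
def skel : PlanarSkeletonFrmFrom graph where
  φ := fun a => a.1
  lip := fun _ _ h i => abs_sub_le h i
  types := types
  frame := by
    rintro ⟨v, k⟩
    refine ⟨((0 : Site 2), k), mem_types k, shiftIso v, ?_, fun w => ?_⟩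
    · show ((0 : Site 2) + v, k) = (v, k)
      rw [zero_add]
    · show w.1 + v = w.1 + (v - 0)
      rw [sub_zero]
  Δ := 6
  degree_le := degree_le
  step := by
    rintro ⟨v, k⟩ i σ
    obtain ⟨b, hb, hφ⟩ := exists_step v k i σ
    exact ⟨b, hb, hφ⟩
  ℓ₀ := 0
  cyl_connected := by
    intro t ht ℓ _
    simp only [types, Z2Rot.types, Finset.mem_insert, Finset.mem_singleton] at ht
    have h0 : t.1 = 0 := by rcases ht with rfl | rfl | rfl | rfl <;> rfl
    have hS : {w : Vtx | w.1 - t.1 ∈ box 2 ℓ} = boxSet ℓ := by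
      ext w; simp only [Set.mem_setOf_eq, h0, sub_zero]
    rw [hS]
    exact boxSet_connected ℓ

/-- The chart of `skel` is the position. [folklore] -/
@[simp] theorem skel_φ (a : Vtx) : skel.φ a = a.1 := rfl

/-- The base types of `skel` are the four vertices `((0,0), k)`. [folklore] -/
theorem skel_types : skel.types = types := rfl

/-- **The four types are PAIRWISE CHART-ALIGNED** (the chart vanishes on every base vertex, so `α := 1` translates by `φ s − φ s' = 0`). [this work] -/
theorem aligned : ∀ s ∈ skel.types, ∀ s' ∈ skel.types, ∃ α : graph ≃g graph, ∀ w, skel.φ (α w) = skel.φ w + (skel.φ s - skel.φ s') := by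
  intro s hs s' hs'
  simp only [skel_types, types, Z2Rot.types, Finset.mem_insert, Finset.mem_singleton] at hs hs'
  have h0 : s.1 = 0 := by rcases hs with rfl | rfl | rfl | rfl <;> rfl
  have h0' : s'.1 = 0 := by rcases hs' with rfl | rfl | rfl | rfl <;> rfl
  exact ⟨RelIso.refl _, fun w => by simp only [skel_φ, h0, h0', sub_zero, add_zero]; rfl⟩

/-- **THEOREM (unconditional).  `θ_v(p_c) = 0` at every vertex of `X′ = Cay(ℤ² ⋊ C₄; ρ, x, ρxρ⁻¹)`** — a Cayley graph of a group with FINITE abelianisation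
(`b₁ = 0`; virtually `ℤ²`), through the aligned multi-type node on the From carrier (p491075) over the GEN node with proxies (p486426).
builds on p205010 (kernel theorem, internal audit signed; external expert review pending). [cite: BenjaminiSchramm1996, Conj. 4; §2] [cite: KozmaNitzan2024, §1 p. 2 (approach 1)] -/
theorem criticalContinuity (v : Vtx) : theta graph v (criticalProbIOf graph v) = 0 :=
  frmFromAligned_criticalContinuity_holds graph skel aligned v

/-- **… and the same-`p` drop at every vertex**: every `p` with `θ_v(p) > 0` admits `q < p` with `θ_v(q) > 0`. [cite: BenjaminiSchramm1996, Conj. 4] -/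
theorem drop (v : Vtx) (p : unitInterval) (hθ : 0 < theta graph v p) : ∃ q : unitInterval, (q : ℝ) < p ∧ 0 < theta graph v q :=
  frmScaledAligned_drop_holds graph skel.toFrmScaled le_rfl aligned v p hθ

end Z2RotSide

end Summit.CriticalPhenomena.PercolationContinuityZ3.Theorems.Transplant

/-! ## ERRATUM (append 2026-08-27, p5-g27 — words only; every declaration above is unchanged)
`X′ = Cay(ℤ²⋊C₄; ρ, x, ρxρ⁻¹)` IS the product graph `ℤ² □ C₄` identically («CayleyZ2RotC4SideStepsBoxProd» `Z2RotSide.graph_eq_boxProd`), hence also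
`Cay(ℤ² × ℤ/4; ±e₀, ±e₁, ±1)` (`b₁ = 2`), and its `θ(p_c) = 0` was already in the tree (V153 clause (5), `K × ℤ²` with `K = ℤ/4`); the heading shift `(v,k) ↦ (v,k+1)`
(right multiplication by `ρ`) is a chart-preserving automorphism («…BoxProd» `headingShiftIso`), so the skeleton `skel` is one-type-able.  The header's words «first customer
of the multi-type nodes … that NO one-type node reaches», «outside every one-type node» and «first Cayley graph of a group with FINITE ABELIANISATION» are WITHDRAWN as
statements about the graph (true of the presentation only); `criticalContinuity` stands as a second route to a product-node customer and a regression instance of the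
multi-type rows.  Rule since adopted lane-wide: «outside every one-type node» needs an Aut-level reason (P5-SHARPNESS §59.3; P3-NILPOTENT §20.7). -/
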